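/-
Copyright (c) 2026 the pub-hodgecm-mathlib formalisation cell (harness21).  Prover seat hodgecm-mathlib-K2E1-p11 (g2), Track B ∕ K2-LIT, h413 =
`stmt-HodgeConjecture-24833`, line `K2_E1_TraceFormulaBeta`, 5Res campaign «ENDGAME BY FAMILIES» ∕ ROADCARD §3′ (M2 v2), deals (255)(y1)∕(257)∕(261): the SELF-DUAL `hU` — on the
`(⊕_{c∈S} W) ⊕₂ L²((0,∞); W)` model of ★ K2E4-p10's `exists_linearIsometry_chiSection_selfDual_cm_two_sqrt` (p860798) a Hecke operator acting on the generators through its symbol `s`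
(`R x_i = x_{τ i}`, Mellin multiplier `s(−·)`, residue coordinates in √-operator currency) satisfies `R(Θ) ⊆ Θ` and `U R = (diag s(c) ⊕ M_{s(½+i·)}) U` on `Θ`, given the Weyl symmetry
`s(½−it) = s(½+it)`.  GENERIC (any Hilbert `H`, finite-dimensional `W`); the CM instantiation is the consumer's destructuring of the ★ `_sqrt` head + ★ B1 + ★ FILE A (three lines).
-/
import Summits.HodgeConjecture.HodgeConjecture.Theorems.K2E1ChiSectionHeckeIntertwiningCMTwo           -- ★ (x1) FILE B2 p860634 (this seat): §0 `apply_mem_topologicalClosure_span_of_generators`, `linearIsometry_apply_eq_of_generators`; brings Hölder `Lp` smul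
import Summits.HodgeConjecture.HodgeConjecture.Theorems.K2E1ChiSectionPlancherelSelfDualCMTwoExplicit    -- ★ (y1-b) p860798 (K2E4-p10): `residue_generator_relation_of_sqrt` (and the `_sqrt` SD head for the consumer)
import HarnessLib

/-!
# (y1-c) — `K2E1SelfDualModelHeckeIntertwining`: `R(Θ) ⊆ Θ` and `U R = (diag s ⊕ M_{s(½+i·)}) U` on the self-dual model `(⊕_{c∈S} W) ⊕₂ L²((0,∞); W)` — the self-dual `hU`, generic

Cell `pub/hodgecm-mathlib`, crux H413 = `stmt-HodgeConjecture-24833`, route `HCCMUnconditional`; dealer K2E1-plan (g7) (255)(y1), (257) («residue coordinate by the per-atom route»), (261)(P-b)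
(the letter `hsymm`).  THEOREMS ONLY (no `def` ∕ `instance` ∕ `notation` ∕ named-fact hypothesis ∕ `sorry`); lane `--kind proof --supports stmt-HodgeConjecture-24833 --as helper` (count-neutral;
closes no socket).  GENERIC: `H` any complex Hilbert space (E1: `L²(X)`), `W` a finite-dimensional inner product space (E1: `span {v_a} ≤ L²(K_U)`), generators `x_i = Σ_a y_{i,a}` (E1: classes
of `θ_{f_{i,a},φ_a}`), the data `(T, r, w, Uiso)` EXACTLY in the shape of ★ `exists_linearIsometry_chiSection_selfDual_cm_two_sqrt`'s conclusion with `⟨v a, _⟩ ↦ vA a`.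
THE MATHEMATICS ([MoeglinWaldspurger1995, II.2.4, IV.3.12]; [ReedSimonI1980, Thm. I.7]).  LETTERS (all with ★ payers): `hRy : R y_{i,a} = y_{τ i,a}` (★ B1 `integratedOperator_eq_of_ae_eq_radialSection_cm_two`
per `(i,a)`), `hmel : mellin f_{τ i,a} z = s(−z)·mellin f_{i,a} z` (★ FILE A `mellin_smoothingProfile`), `hsymm : s(½−it) = s(½+it)` (★ `K2E1ChiSymbolWeylSymmetryM1CMTwo.symbol_axis_symm` ∘ the M1 FE),
`hσ : s(½+i·) ∈ L^∞((0,∞))` (★ B2 `norm_symbol_axis_le` pattern).  (§1) the model multiplier `Mop(q, w) = ((s(c)•q_c)_c, σ•w)` as a bounded operator on `(⊕_c W) ⊕₂ L²((0,∞);W)` (finite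
dimension on the atoms, Hölder `∞·2 → 2` on the continuous part — no `def`, an `∃`-packaged `→L[ℂ]`).  (§2) the GENERATOR RELATIONS on the model: residue coordinate `r_{τ i} c = s(c)•r_i c`
(★ `residue_generator_relation_of_sqrt`: `Ψ̂_{τ i}(−c) = s(c)•Ψ̂_i(−c)` by `hmel` at `z = −c`), continuous coordinate `σ•(κ•w_i) = κ•w_{τ i}` a.e. (`hmel` at `−(½±it)`, **`hsymm`** for the
`M(½−it)`-term, `ℂ`-linearity of `M`).  (§3) HEAD **`hU_selfDual_of_generators`**: `R(Θ) ⊆ Θ` and `Uiso(R v) = Mop(Uiso v)` for all `v ∈ Θ` (★ B2 §0), with `Mop` spelled on components.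
* §1 `exists_diag_smul`, **`exists_prodMultiplier`**.  * §2 `residue_coord_relation`, `axis_coord_relation`.  * §3 **`hU_selfDual_of_generators`**.
HONEST LABEL.  Count-neutral helper; proves no printed statement; letter-free except the four named letters (★ payers) and the SD model data (★ p860798).  HC_CM is proved only modulo the 7
printed citations (2 remaining named inputs: hLiu418 = `stmt-HodgeConjecture-24832`, h413 = `stmt-HodgeConjecture-24833`) until rung 0 closes.

## References
* [MoeglinWaldspurger1995] C. Mœglin, J.-L. Waldspurger, *Spectral decomposition and Eisenstein series* (1995), II.2.4, IV.3.12.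
* [ReedSimonI1980] M. Reed, B. Simon, *Methods of Modern Mathematical Physics I* (1980), Thm. I.7.
-/

set_option autoImplicit false
-- the mandated namespace repeats `HodgeConjecture.HodgeConjecture`, as in every `Theorems/*.lean` of this sub-problem
set_option linter.dupNamespace false

noncomputable section

open MeasureTheory MeasureTheory.Measure Set Filter Topology Complex Submodule
open scoped NNReal ENNReal InnerProductSpace Real
open Summit.HodgeConjecture.HodgeConjecture.Cruxes.H413.K2E1PlancherelIsometryOfForm (mem_topologicalClosure_span)
open Summit.HodgeConjecture.HodgeConjecture.Cruxes.H413.K2E1ChiSectionHeckeIntertwiningCMTwo (apply_mem_topologicalClosure_span_of_generators linearIsometry_apply_eq_of_generators)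
open Summit.HodgeConjecture.HodgeConjecture.Cruxes.H413.K2E1ChiSectionPlancherelSelfDualCMTwoExplicit (residue_generator_relation_of_sqrt)

namespace Summit.HodgeConjecture.HodgeConjecture.Cruxes.H413.K2E1SelfDualModelHeckeIntertwining

variable {W : Type*} [NormedAddCommGroup W] [InnerProductSpace ℂ W] [FiniteDimensional ℂ W]

/-! ## §1 The model multiplier `(q, w) ↦ ((s(c)•q_c)_c, σ•w)` as a bounded operator -/

omit [FiniteDimensional ℂ W] in
/-- The diagonal scalar operator `(q)_c ↦ (s(c)•q_c)_c` on `⊕_{c} W` (finite index) as a bounded linear map. [folklore] -/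
theorem exists_diag_smul [FiniteDimensional ℂ W] {γ : Type*} [Fintype γ] (s : γ → ℂ) :
    ∃ D : PiLp 2 (fun _ : γ => W) →L[ℂ] PiLp 2 (fun _ : γ => W), ∀ (q : PiLp 2 (fun _ : γ => W)) (c : γ), D q c = s c • q c := by
  refine ⟨LinearMap.toContinuousLinearMap
    { toFun := fun q => WithLp.toLp 2 (fun c => s c • q c)
      map_add' := fun q₁ q₂ => by ext c; simp [smul_add]
      map_smul' := fun a q => by ext c; simp [smul_comm (s _) a] }, fun q c => rfl⟩

/-- **THE MODEL MULTIPLIER**: on `(⊕_c W) ⊕₂ L²(m; W)` the map `(q, w) ↦ ((s(c)•q_c)_c, σ•w)` (`σ ∈ L^∞(m)`, Hölder `∞·2 → 2`) is a bounded linear operator. [cite: ReedSimonI1980, Thm. I.7] -/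
theorem exists_prodMultiplier {X : Type*} [MeasurableSpace X] {m : Measure X} [ENNReal.HolderTriple ∞ 2 2] {γ : Type*} [Fintype γ] (s : γ → ℂ) {σ : X → ℂ} (hσ : MemLp σ ∞ m) :
    ∃ Mop : WithLp 2 (PiLp 2 (fun _ : γ => W) × Lp W 2 m) →L[ℂ] WithLp 2 (PiLp 2 (fun _ : γ => W) × Lp W 2 m),
      ∀ (q : PiLp 2 (fun _ : γ => W)) (w : Lp W 2 m), Mop (WithLp.toLp 2 (q, w)) = WithLp.toLp 2 (WithLp.toLp 2 (fun c => s c • q c), (hσ.toLp σ : Lp ℂ ∞ m) • w) := by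
  obtain ⟨D, hD⟩ := exists_diag_smul (W := W) s
  have hMex : ∃ Mσ : Lp W 2 m →L[ℂ] Lp W 2 m, ∀ g, Mσ g = (hσ.toLp σ : Lp ℂ ∞ m) • g :=
    ⟨LinearMap.mkContinuous
      { toFun := fun g => (hσ.toLp σ : Lp ℂ ∞ m) • g
        map_add' := fun g₁ g₂ => MeasureTheory.Lp.add_smul _ g₁ g₂
        map_smul' := fun a g => (MeasureTheory.Lp.smul_comm a _ g).symm }
      ‖(hσ.toLp σ : Lp ℂ ∞ m)‖ (fun g => MeasureTheory.Lp.norm_smul_le _ g), fun g => rfl⟩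
  obtain ⟨Mσ, hMσ⟩ := hMex
  refine ⟨((WithLp.prodContinuousLinearEquiv 2 ℂ (PiLp 2 (fun _ : γ => W)) (Lp W 2 m)).symm : _ →L[ℂ] _).comp
      ((D.prodMap Mσ).comp (WithLp.prodContinuousLinearEquiv 2 ℂ (PiLp 2 (fun _ : γ => W)) (Lp W 2 m) : _ →L[ℂ] _)), fun q w => ?_⟩
  have hDq : D q = WithLp.toLp 2 (fun c => s c • q c) := by ext c; rw [hD]
  simp only [ContinuousLinearMap.comp_apply, ContinuousLinearEquiv.coe_coe, WithLp.prodContinuousLinearEquiv_apply, WithLp.prodContinuousLinearEquiv_symm_apply]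
  rw [ContinuousLinearMap.coe_prodMap', Prod.map_apply, hDq, hMσ]

/-! ## §2 The generator relations on the model -/

omit [FiniteDimensional ℂ W] in
/-- **RESIDUE COORDINATE**: `r_j = (s(c)•r_i c)_c` when `mellin f_{j,a} = s(−·)·mellin f_{i,a}` for every `a` (so `Ψ̂_j(−c) = s(c)•Ψ̂_i(−c)`; ★ `residue_generator_relation_of_sqrt`).
[cite: MoeglinWaldspurger1995, II.2.4, IV.3.12] -/
theorem residue_coord_relation {ι α : Type*} [Fintype α] (vA : α → W) {f : ι → α → ℝ → ℂ} (S : Finset ℝ) {T : ↥S → W →L[ℂ] W} {κ : ℂ}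
    {r : ι → PiLp 2 (fun _ : ↥S => W)} (hr : ∀ i (c : ↥S), r i c = κ • T c (∑ a, mellin (f i a) (-((c : ℝ) : ℂ)) • vA a))
    {s : ℂ → ℂ} {i j : ι} (hmel : ∀ a z, mellin (f j a) z = s (-z) * mellin (f i a) z) :
    WithLp.toLp 2 (fun c : ↥S => s ((c : ℝ) : ℂ) • r i c) = r j := by
  ext c
  refine (residue_generator_relation_of_sqrt hr (s := fun c : ↥S => s ((c : ℝ) : ℂ)) (i := i) (j := j) (fun c => ?_) c).symm
  rw [Finset.smul_sum]
  refine Finset.sum_congr rfl fun a _ => ?_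
  rw [hmel a, neg_neg, mul_smul]

omit [FiniteDimensional ℂ W] in
/-- **CONTINUOUS COORDINATE**: `σ•(κ•w_i) = κ•w_j` in `L²((0,∞); W)`, `σ(t) = s(½+it)`, when `mellin f_{j,a} = s(−·)·mellin f_{i,a}` and **`s(½−it) = s(½+it)`** (the `M(½−it)`-term; `M` is
`ℂ`-linear).  A.e. computation (Mathlib `Lp.coeFn_lpSMul`, `Lp.coeFn_smul`). [cite: MoeglinWaldspurger1995, II.2.4] -/
theorem axis_coord_relation [ENNReal.HolderTriple ∞ 2 2] {ι α : Type*} [Fintype α] (vA : α → W) {f : ι → α → ℝ → ℂ} (M : ℂ → W →ₗ[ℂ] W)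
    {w : ι → Lp W 2 ((volume : Measure ℝ).restrict (Ioi 0))}
    (hw : ∀ i, (w i : ℝ → W) =ᵐ[(volume : Measure ℝ).restrict (Ioi 0)] fun t =>
      (∑ a, mellin (f i a) (-((((1 / 2 : ℝ)) : ℂ) + t * I)) • vA a) +
        M ((((1 / 2 : ℝ)) : ℂ) + ((-t : ℝ) : ℂ) * I) (∑ a, mellin (f i a) (-((((1 / 2 : ℝ)) : ℂ) + ((-t : ℝ) : ℂ) * I)) • vA a))
    {s : ℂ → ℂ} (hσ : MemLp (fun t : ℝ => s ((((1 / 2 : ℝ)) : ℂ) + t * I)) ∞ ((volume : Measure ℝ).restrict (Ioi 0)))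
    (hsymm : ∀ t : ℝ, s ((((1 / 2 : ℝ)) : ℂ) + ((-t : ℝ) : ℂ) * I) = s ((((1 / 2 : ℝ)) : ℂ) + t * I))
    {i j : ι} (hmel : ∀ a z, mellin (f j a) z = s (-z) * mellin (f i a) z) (κ : ℂ) :
    (hσ.toLp _ : Lp ℂ ∞ ((volume : Measure ℝ).restrict (Ioi 0))) • (κ • w i) = κ • w j := by
  refine Lp.ext_iff.2 ?_
  refine (Lp.coeFn_lpSMul (hσ.toLp _) (κ • w i)).trans ?_
  filter_upwards [hσ.coeFn_toLp, Lp.coeFn_smul κ (w i), Lp.coeFn_smul κ (w j), hw i, hw j] with t ht hκi hκj hi hj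
  rw [Pi.smul_apply', ht, hκi, hκj, Pi.smul_apply, Pi.smul_apply, hi, hj]
  have hA : ∑ a, mellin (f j a) (-((((1 / 2 : ℝ)) : ℂ) + t * I)) • vA a = s ((((1 / 2 : ℝ)) : ℂ) + t * I) • ∑ a, mellin (f i a) (-((((1 / 2 : ℝ)) : ℂ) + t * I)) • vA a := by
    rw [Finset.smul_sum]
    refine Finset.sum_congr rfl fun a _ => ?_
    rw [hmel a, neg_neg, mul_smul]
  have hB : ∑ a, mellin (f j a) (-((((1 / 2 : ℝ)) : ℂ) + ((-t : ℝ) : ℂ) * I)) • vA a =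
      s ((((1 / 2 : ℝ)) : ℂ) + t * I) • ∑ a, mellin (f i a) (-((((1 / 2 : ℝ)) : ℂ) + ((-t : ℝ) : ℂ) * I)) • vA a := by
    rw [Finset.smul_sum]
    refine Finset.sum_congr rfl fun a _ => ?_
    rw [hmel a, neg_neg, hsymm t, mul_smul]
  rw [hA, hB, LinearMap.map_smul, ← smul_add, smul_comm]

/-! ## §3 The self-dual `hU` on the closed span -/

/-- **THE SELF-DUAL `hU` (generic)**: with the model data `(T, r, w, Uiso)` of ★ `exists_linearIsometry_chiSection_selfDual_cm_two_sqrt` (`⟨v a, _⟩ ↦ vA a`), a bounded `R` on `H` acting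
on the pure tensors by `R y_{i,a} = y_{τ i,a}` (★ B1), Mellin multiplier `s(−·)` (★ FILE A), Weyl symmetry `s(½−it) = s(½+it)` (★ `symbol_axis_symm` ∘ FE) and `s(½+i·) ∈ L^∞`:
`R(Θ) ⊆ Θ` and, for every `v ∈ Θ = closure span {Σ_a y_{i,a}}`, **`Uiso(R v) = ((s(c) • (Uiso v)_c)_c, σ • (Uiso v)_cont)`** — `U R(h) U* = diag s(z_c) ⊕ M_{s(½+i·)}` on the self-dual
block. [cite: MoeglinWaldspurger1995, II.2.4, IV.3.12] [cite: ReedSimonI1980, Thm. I.7] -/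
theorem hU_selfDual_of_generators [ENNReal.HolderTriple ∞ 2 2] {H : Type*} [NormedAddCommGroup H] [InnerProductSpace ℂ H] [CompleteSpace H]
    {ι α : Type*} [Fintype α] (vA : α → W) (y : ι → α → H) {f : ι → α → ℝ → ℂ} (M : ℂ → W →ₗ[ℂ] W) (S : Finset ℝ) {C : ℝ}
    (T : ↥S → W →L[ℂ] W) (r : ι → PiLp 2 (fun _ : ↥S => W)) (w : ι → Lp W 2 ((volume : Measure ℝ).restrict (Ioi 0)))
    (Uiso : (span ℂ (Set.range fun i => ∑ a, y i a)).topologicalClosure →ₗᵢ[ℂ] WithLp 2 (PiLp 2 (fun _ : ↥S => W) × Lp W 2 ((volume : Measure ℝ).restrict (Ioi 0))))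
    (hr_apply : ∀ i (c : ↥S), r i c = ((Real.sqrt C : ℝ) : ℂ) • T c (∑ a, mellin (f i a) (-((c : ℝ) : ℂ)) • vA a))
    (hw : ∀ i, (w i : ℝ → W) =ᵐ[(volume : Measure ℝ).restrict (Ioi 0)] fun t =>
      (∑ a, mellin (f i a) (-((((1 / 2 : ℝ)) : ℂ) + t * I)) • vA a) +
        M ((((1 / 2 : ℝ)) : ℂ) + ((-t : ℝ) : ℂ) * I) (∑ a, mellin (f i a) (-((((1 / 2 : ℝ)) : ℂ) + ((-t : ℝ) : ℂ) * I)) • vA a))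
    (hU : ∀ i, Uiso ⟨∑ a, y i a, mem_topologicalClosure_span (fun i => ∑ a, y i a) i⟩ = WithLp.toLp 2 (r i, ((Real.sqrt (C * (2 * π)⁻¹) : ℝ) : ℂ) • w i))
    (R : H →L[ℂ] H) (τ : ι → ι) (hRy : ∀ i a, R (y i a) = y (τ i) a)
    {s : ℂ → ℂ} (hmel : ∀ i a z, mellin (f (τ i) a) z = s (-z) * mellin (f i a) z)
    (hsymm : ∀ t : ℝ, s ((((1 / 2 : ℝ)) : ℂ) + ((-t : ℝ) : ℂ) * I) = s ((((1 / 2 : ℝ)) : ℂ) + t * I))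
    (hσ : MemLp (fun t : ℝ => s ((((1 / 2 : ℝ)) : ℂ) + t * I)) ∞ ((volume : Measure ℝ).restrict (Ioi 0)))
    (v : H) (hv : v ∈ (span ℂ (Set.range fun i => ∑ a, y i a)).topologicalClosure) :
    ∃ hRv : R v ∈ (span ℂ (Set.range fun i => ∑ a, y i a)).topologicalClosure,
      Uiso ⟨R v, hRv⟩ = WithLp.toLp 2 (WithLp.toLp 2 (fun c : ↥S => s ((c : ℝ) : ℂ) • (Uiso ⟨v, hv⟩).fst c),
        (hσ.toLp _ : Lp ℂ ∞ ((volume : Measure ℝ).restrict (Ioi 0))) • (Uiso ⟨v, hv⟩).snd) := by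
  obtain ⟨Mop, hMop⟩ := exists_prodMultiplier (W := W) (m := (volume : Measure ℝ).restrict (Ioi 0)) (fun c : ↥S => s ((c : ℝ) : ℂ)) hσ
  have hR : ∀ i, R ((fun i => ∑ a, y i a) i) = (fun i => ∑ a, y i a) (τ i) := fun i => by
    show R (∑ a, y i a) = ∑ a, y (τ i) a
    rw [_root_.map_sum]
    exact Finset.sum_congr rfl fun a _ => hRy i a
  have hM : ∀ i, Mop ((fun i => WithLp.toLp 2 (r i, ((Real.sqrt (C * (2 * π)⁻¹) : ℝ) : ℂ) • w i)) i) =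
      (fun i => WithLp.toLp 2 (r i, ((Real.sqrt (C * (2 * π)⁻¹) : ℝ) : ℂ) • w i)) (τ i) := fun i => by
    show Mop (WithLp.toLp 2 (r i, _)) = WithLp.toLp 2 (r (τ i), _)
    rw [hMop, residue_coord_relation vA S hr_apply (hmel i), axis_coord_relation vA M hw hσ hsymm (hmel i)]
  refine ⟨apply_mem_topologicalClosure_span_of_generators _ R τ hR hv, ?_⟩
  rw [linearIsometry_apply_eq_of_generators (u := fun i => WithLp.toLp 2 (r i, ((Real.sqrt (C * (2 * π)⁻¹) : ℝ) : ℂ) • w i)) Uiso hU R Mop τ hR hM hv]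
  exact hMop (Uiso ⟨v, hv⟩).fst (Uiso ⟨v, hv⟩).snd

end Summit.HodgeConjecture.HodgeConjecture.Cruxes.H413.K2E1SelfDualModelHeckeIntertwining

end
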